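import Summits.QuantumFields.YangMills.Theorems.FluctuationComparisonRegPrIntLS2BetaMinActionRegPrContinuousOn
import Summits.QuantumFields.YangMills.Theorems.FluctuationComparisonRegPrIntLWreg
import Literature.MathematicalPhysics.QuantumFieldTheory.Balaban1983to89.T3AvgDivergenceSplit
import HarnessLib

/-!
# S2β · THE SMALL-FIELD TESTED FUNCTION `f^λ = log heightDensityCan + β·minActionRegPr` IS CONTINUOUS ON THE WINDOW, EVERY RUN `K ≥ J`,
# EVERY WEIGHT COUPLING — at every block size `L ≥ 5` with ZERO letters (WREG ∧ the datum-continuity of the background action)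

Cell `ym3-torus` (YM ladder rung R3 = continuum `SU(2)` Yang–Mills on the three-torus at fixed lattice data — a RUNG: NOT d = 4, NOT infinite volume,
NOT a mass gap, NOT Clay).  Width seat `ym3-torus-px10` (gen 20), FILE B; helper of the crux `stmt-QuantumFields-20520`
(`…Theses.UnitScaleTilt.FluctuationComparisonRegPrIntL`), `--supports … --as helper`, count-neutral, DEFINITION-FREE (0 `def`, 0 `instance`,
0 `notation`, 0 `sorry`, default heartbeats).

WHAT.  The registry's small-field tested function (`Lines/semiclassical_s2beta.lean` :327 `fluctAtCan F γ b₀ p₀ ε₀ hJK λ V :=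
log heightDensityCan F (γ/λ) hJK (histGood at θBal γ) V + β_K(γ/λ)·minActionRegPr F J K hJK ε₀ V`; the rows 1L4ᶜ∘ ∕ H4ᶜ∘ ∕ S2β test its four-points
POINTWISE on the window) is CONTINUOUS ON THE WINDOW `{PlaqSmall (θBal F.L γ b₀ p₀ J)}` for every `J ≤ K`, every weight coupling `γ′ > 0` and every
coefficient `β`:
* the first summand by ✓WREG (`FluctuationComparisonRegPrIntLWreg.windowRegularity`: the window lies in `regSet` of the small-history height density,
  where the canonical version is continuous — `Node00.continuousOn_canonVersion` — and positive, so `log` is continuous there);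
* the second by FILE A ✓`…S2BetaMinActionRegPrContinuousOn.continuousOn_minActionRegPr_window_five` at every `J < K`, and by §1 at the corner `J = K`
  (over the one-point fibre the regular minimal action IS the Wilson action once `4·θBal(K) < ε₀`: lit ✓`T3AvgDivergenceSplit.regPr_of_plaqSmall`).
§1 `minActionRegPr_self_eq_wilsonAction4`, `continuousOn_minActionRegPr_self`; §2 ★★ `continuousOn_minActionRegPr_window_five_le` (FILE A's window edition
extended to ALL `J ≤ K`); §3 ★★★ `continuousOn_smallFieldIntegrand_five` (the displayed function, every `L ≥ 5`, zero letters) and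
★★ `continuousOn_smallFieldIntegrand_of_thm1` (every odd `L > 1`, from the Thm-1 letter).
USE (the door this opens, UV3-NODE §45.7's generic remark): an A.E. edition of any pointwise four-point row whose tested function is `f^λ` upgrades to the
pointwise row by ✓px10 g19 FILE J `…LargeFieldGasFourPtOfAEIdentity.forall_abs_le_of_ae_of_continuousOn` (Haar resampling charges open sets) — the SF engine
may state its representation identities `dU_J`-a.e. on the window, as the LF engine already may.

HONEST.  Composition BY NAME (WREG, FILE A, the corner); nothing of Bałaban's analysis is added; print's Prop. 9 (analyticity of the background in the datum)
is NOT proved; the five registered ∘-stubs, S2β, crux 20520, 19936, 19200 and `YM3TorusSU2` are NOT proved; `L = 3` stays behind the Thm-1 letter; no summit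
statement is proved by a helper; rung R3 = SU(2) YM₃ on T³ at fixed lattice data — NOT d = 4, NOT infinite volume, NOT a mass gap, NOT Clay; the Yang–Mills
mass gap is NOT proved.  Axioms standard.

References: T. Bałaban, CMP **102** (1985) 277–309 [Balaban1985Variational] ((2), (6) p.278, Thm 1 (8) p.279, Prop. 9 p.309); CMP **102** (1985) 255–275
[Balaban1985UV3] ((2) p.256, (7) p.257, (41) p.266); CMP **109** (1987) 249–301 [Balaban1987RG1] ((0.4) p.253, (2.10) p.267); CMP **99** (1985) 75–102
[Balaban1985RegularSpaces] ((1.9) p.77).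
-/

set_option autoImplicit false

noncomputable section

namespace Summit.QuantumFields.YangMills.Theorems.FluctuationComparisonRegPrIntLS2BetaSmallFieldIntegrandContinuousOn

open Set Filter Topology
open Literature.MathematicalPhysics.QuantumFieldTheory.Balaban1983to89
open Literature.MathematicalPhysics.QuantumFieldTheory.Balaban1983to89.T3ContinuumYM3Torus
open Literature.MathematicalPhysics.QuantumFieldTheory.Balaban1983to89.T3UnitLawDensityEML (ℰp)
open Literature.MathematicalPhysics.QuantumFieldTheory.Balaban1983to89.T3UnitScaleTilt (θBal histGood)
open Literature.MathematicalPhysics.QuantumFieldTheory.Balaban1983to89.T3PrintedRegularMinimiser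
  (RegPr regFibrePr minActionRegPr mem_regFibrePr_iff minActionRegPr_le)
open Literature.MathematicalPhysics.QuantumFieldTheory.Balaban1983to89.T3PrintedMinimiserExistence (Thm1GlobalMinAt minActionRegPr_eq_of_isMinOn)
open Literature.MathematicalPhysics.QuantumFieldTheory.Balaban1983to89.T3RegularMinimiser (regThreshold)
open Literature.MathematicalPhysics.QuantumFieldTheory.Balaban1983to89.T3ConstrainedMinimiser (fibre)
open Literature.MathematicalPhysics.QuantumFieldTheory.Balaban1983to89.T3DescentFibreTower (mem_fibre_iff fibre_self)
open Literature.MathematicalPhysics.QuantumFieldTheory.Balaban1983to89.T3TiltDescent (descendTo heightDensity)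
open scoped Literature.MathematicalPhysics.QuantumFieldTheory.Balaban1983to89.T3OrbitAverage
open Literature.MathematicalPhysics.QuantumFieldTheory.Balaban1983to89.T3MinimiserStabilityReduction (θBal_pos)
open Literature.MathematicalPhysics.QuantumFieldTheory.Balaban1983to89.T3ThresholdSmallness (exists_forall_θBal_le)
open Literature.MathematicalPhysics.QuantumFieldTheory.Balaban1983to89.T3AvgDivergenceSplit (regPr_of_plaqSmall)
open Summit.QuantumFields.YangMills.BalabanUVNodes.N07DirectMethod (continuous_wilsonAction4)
open Summit.QuantumFields.YangMills.Theorems.FluctuationComparisonRegPrIntLWregGlue (heightDensityCan WindowRegularity)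
open Summit.QuantumFields.YangMills.Theorems.FluctuationComparisonRegPrIntLWreg (windowRegularity)
open Summit.QuantumFields.YangMills.Theorems.FluctuationComparisonRegPrIntLS2BetaMinActionRegPrContinuousOn
  (continuousOn_minActionRegPr_five continuousOn_minActionRegPr_window_of_thm1)

/-! ## §1 The corner `J = K`: over the one-point fibre the regular minimal action is the Wilson action -/

section Corner

variable (F : T3Family)

/-- **THE CORNER `J = K`**: a `δ`-small datum with `δ ≤ ε₀`, `4δ < ε₀` is its own print-regular configuration over the one-point fibre `{V}` (both clauses
of (2): lit ✓`regPr_of_plaqSmall`), so `minActionRegPr F K K _ ε₀ V = A(V)`. [cite: Balaban1985Variational, (2) and (6) p.278] -/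
theorem minActionRegPr_self_eq_wilsonAction4 (K : ℕ) {ε₀ δ : ℝ} (hδ : δ ≤ ε₀) (h4 : 4 * δ < ε₀)
    {V : GaugeField (F.P K) 0 (Matrix.specialUnitaryGroup (Fin 2) ℂ)} (hV : PlaqSmall δ V) :
    minActionRegPr F K K le_rfl ε₀ V = wilsonAction4 V := by
  have hreg : RegPr F K K ε₀ V := by
    refine regPr_of_plaqSmall F hV ?_ ?_
    · show δ ≤ ε₀ * ((F.L : ℝ)⁻¹) ^ (2 * (K - K))
      rw [Nat.sub_self, mul_zero, pow_zero, mul_one]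
      exact hδ
    · rw [Nat.sub_self, mul_zero, pow_zero, mul_one]
      exact h4
  have hmem : V ∈ regFibrePr F K K le_rfl ε₀ V := (mem_regFibrePr_iff F).mpr ⟨by rw [fibre_self]; rfl, hreg⟩
  refine (minActionRegPr_eq_of_isMinOn F hmem fun W hW => ?_).symm
  have hWV : W = V := by
    have h := ((mem_regFibrePr_iff F).mp hW).1
    rwa [fibre_self] at h
  rw [hWV]
  exact (le_refl _ : wilsonAction4 V ≤ wilsonAction4 V)

/-- At the corner `J = K` the regular minimal action is CONTINUOUS on every plaquette class `{PlaqSmall δ}` with `δ ≤ ε₀`, `4δ < ε₀` (it is the Wilson action there).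
[cite: Balaban1985Variational, (5)-(6) p.278] -/
theorem continuousOn_minActionRegPr_self (K : ℕ) {ε₀ δ : ℝ} (hδ : δ ≤ ε₀) (h4 : 4 * δ < ε₀) :
    ContinuousOn (minActionRegPr F K K le_rfl ε₀) {V : GaugeField (F.P K) 0 (Matrix.specialUnitaryGroup (Fin 2) ℂ) | PlaqSmall δ V} :=
  (continuous_wilsonAction4 (N := 2)).continuousOn.congr fun _ hV => minActionRegPr_self_eq_wilsonAction4 F K hδ h4 hV

end Corner

/-! ## §2 FILE A's window edition at every `J ≤ K` -/

section Window

/-- ★★ **THE BACKGROUND ACTION IS CONTINUOUS IN THE DATUM ON THE WINDOW, EVERY `J ≤ K`, EVERY `L ≥ 5`, ZERO LETTERS**: FILE A's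
`continuousOn_minActionRegPr_five` at `J < K` and §1's corner at `J = K` (the coupling threshold also enforces `4·θBal(i) < ε₀`).
[cite: Balaban1985Variational, Thm 1 (8) p.279 and Prop 9 p.309] -/
theorem continuousOn_minActionRegPr_window_five_le (L : ℕ) (h5 : 5 ≤ L) (b₀ p₀ : ℝ) (hb : 0 < b₀) :
    ∃ ε₁ : ℝ, 0 < ε₁ ∧ ∀ (ε₀ : ℝ), 0 < ε₀ → ε₀ ≤ ε₁ →
      ∃ γ₁ : ℝ, 0 < γ₁ ∧ ∀ (F : T3Family) (γ : ℝ), F.L = L → 0 < γ → γ ≤ γ₁ →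
        ∀ (J K : ℕ) (hJK : J ≤ K), ContinuousOn (minActionRegPr F J K hJK ε₀) {V | PlaqSmall (θBal F.L γ b₀ p₀ J) V} := by
  obtain ⟨a₁, B₃, e, ha₁, hB₃, he, hmain⟩ := continuousOn_minActionRegPr_five L h5
  have hL : 1 ≤ L := by omega
  refine ⟨e, he, fun ε₀ hε₀ hε₀e => ?_⟩
  -- datum radius: `θBal ≤ min (min a₁ (ε₀/(2B₃))) (ε₀/5)`
  obtain ⟨γ₀, hγ₀, hθ⟩ := exists_forall_θBal_le hL b₀ p₀
    (lt_min (lt_min ha₁ (div_pos hε₀ (mul_pos two_pos hB₃))) (div_pos hε₀ (by norm_num : (0 : ℝ) < 5)))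
  refine ⟨min γ₀ 1, lt_min hγ₀ one_pos, fun F γ hF hγ hγle J K hJK => ?_⟩
  have hγ1 : γ ≤ 1 := hγle.trans (min_le_right _ _)
  have hγ0 : γ ≤ γ₀ := hγle.trans (min_le_left _ _)
  have hLF : 1 ≤ F.L := F.hL.2.le
  have hθJ : θBal F.L γ b₀ p₀ J ≤ min (min a₁ (ε₀ / (2 * B₃))) (ε₀ / 5) := by rw [hF]; exact hθ γ hγ hγ0 J
  rcases Nat.lt_or_ge J K with hlt | hge
  · have hε₁ : 0 < θBal F.L γ b₀ p₀ J := θBal_pos hLF hγ hγ1 hb p₀ J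
    have hlo : B₃ * θBal F.L γ b₀ p₀ J < ε₀ := by
      have h1 : θBal F.L γ b₀ p₀ J ≤ ε₀ / (2 * B₃) := (hθJ.trans (min_le_left _ _)).trans (min_le_right _ _)
      rw [le_div_iff₀ (mul_pos two_pos hB₃)] at h1
      nlinarith
    exact hmain F hF hlt _ ε₀ hε₁ ((hθJ.trans (min_le_left _ _)).trans (min_le_left _ _)) hlo hε₀e
  · obtain rfl : J = K := le_antisymm hJK hge
    have h5' : θBal F.L γ b₀ p₀ J ≤ ε₀ / 5 := hθJ.trans (min_le_right _ _)
    exact continuousOn_minActionRegPr_self F J (by linarith) (by linarith)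

/-- The same at every odd `L > 1` from the Thm-1 letter (FILE A's `continuousOn_minActionRegPr_window_of_thm1` + the corner).
[cite: Balaban1985Variational, Thm 1 (8) p.279 and Prop 9 p.309] -/
theorem continuousOn_minActionRegPr_window_of_thm1_le
    (hT : ∀ L : ℕ, Odd L → 1 < L → ∃ a₀ a₁ B₃ : ℝ, 0 < a₀ ∧ 0 < a₁ ∧ 0 < B₃ ∧ Thm1GlobalMinAt L a₀ a₁ B₃) :
    ∀ (L : ℕ) (b₀ p₀ : ℝ), 0 < b₀ → 0 < p₀ → ∃ ε₁ : ℝ, 0 < ε₁ ∧ ∀ (ε₀ : ℝ), 0 < ε₀ → ε₀ ≤ ε₁ →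
      ∃ γ₁ : ℝ, 0 < γ₁ ∧ ∀ (F : T3Family) (γ : ℝ), F.L = L → 0 < γ → γ ≤ γ₁ →
        ∀ (J K : ℕ) (hJK : J ≤ K), ContinuousOn (minActionRegPr F J K hJK ε₀) {V | PlaqSmall (θBal F.L γ b₀ p₀ J) V} := by
  intro L b₀ p₀ hb hp
  obtain ⟨ε₁, hε₁, hA⟩ := continuousOn_minActionRegPr_window_of_thm1 hT L b₀ p₀ hb hp
  refine ⟨ε₁, hε₁, fun ε₀ hε₀ hε₀e => ?_⟩
  obtain ⟨γA, hγA, hA'⟩ := hA ε₀ hε₀ hε₀e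
  by_cases hL : 1 ≤ L
  swap
  · refine ⟨1, one_pos, fun F γ hF _ _ J K hJK => ?_⟩
    exact absurd (hF ▸ F.hL.2.le : 1 ≤ L) hL
  obtain ⟨γ₀, hγ₀, hθ⟩ := exists_forall_θBal_le hL b₀ p₀ (div_pos hε₀ (by norm_num : (0 : ℝ) < 5))
  refine ⟨min γA γ₀, lt_min hγA hγ₀, fun F γ hF hγ hγle J K hJK => ?_⟩
  rcases Nat.lt_or_ge J K with hlt | hge
  · exact hA' F γ hF hγ (hγle.trans (min_le_left _ _)) J K hlt
  · obtain rfl : J = K := le_antisymm hJK hge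
    have h5' : θBal F.L γ b₀ p₀ J ≤ ε₀ / 5 := by rw [hF]; exact hθ γ hγ (hγle.trans (min_le_right _ _)) J
    exact continuousOn_minActionRegPr_self F J (by linarith) (by linarith)

end Window

/-! ## §3 ★★★ The small-field tested function is continuous on the window -/

section Integrand

/-- **THE DISPLAYED FUNCTION IS CONTINUOUS ON THE WINDOW, GIVEN THE TWO LETTERS AT ONE DATUM SET**: if the window lies in `regSet` of the height density and the
canonical version is positive there (WREG's two conjuncts at `(J, K, γ′)`), and `minActionRegPr` is continuous on the window, then so is
`V ↦ log heightDensityCan V + β·minActionRegPr V`. [cite: Balaban1985UV3, (41) p.266; Balaban1987RG1, (2.10) p.267] -/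
theorem continuousOn_integrand_of_letters (F : T3Family) {γ γ' b₀ p₀ ε₀ β : ℝ} {J K : ℕ} (hJK : J ≤ K)
    (hR : {U : GaugeField (F.P J) 0 (Matrix.specialUnitaryGroup (Fin 2) ℂ) | PlaqSmall (θBal F.L γ b₀ p₀ J) U} ⊆
      Node00.regSet (fieldMeasure (F.P J) 0 (Matrix.specialUnitaryGroup (Fin 2) ℂ))
        (heightDensity F γ' hJK (histGood F ℰp (θBal F.L γ b₀ p₀) K J)))
    (hP : ∀ U : GaugeField (F.P J) 0 (Matrix.specialUnitaryGroup (Fin 2) ℂ), PlaqSmall (θBal F.L γ b₀ p₀ J) U →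
      0 < heightDensityCan F γ' hJK (histGood F ℰp (θBal F.L γ b₀ p₀) K J) U)
    (hm : ContinuousOn (minActionRegPr F J K hJK ε₀) {V | PlaqSmall (θBal F.L γ b₀ p₀ J) V}) :
    ContinuousOn (fun V => Real.log (heightDensityCan F γ' hJK (histGood F ℰp (θBal F.L γ b₀ p₀) K J) V)
        + β * minActionRegPr F J K hJK ε₀ V) {V | PlaqSmall (θBal F.L γ b₀ p₀ J) V} := by
  haveI : SecondCountableTopology (GaugeField (F.P J) 0 (Matrix.specialUnitaryGroup (Fin 2) ℂ)) := T3OrbitAverage.instSecondCountableGaugeField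
  haveI : BorelSpace (GaugeField (F.P J) 0 (Matrix.specialUnitaryGroup (Fin 2) ℂ)) := T3OrbitAverage.instBorelSpaceGaugeField
  haveI : (fieldMeasure (F.P J) 0 (Matrix.specialUnitaryGroup (Fin 2) ℂ)).IsOpenPosMeasure :=
    B12ContinuousTransportInvariance.isOpenPosMeasure_fieldMeasure_SU (N := 2) (F.P J) 0
  have hc : ContinuousOn (heightDensityCan F γ' hJK (histGood F ℰp (θBal F.L γ b₀ p₀) K J)) {V | PlaqSmall (θBal F.L γ b₀ p₀ J) V} :=
    (Node00.continuousOn_canonVersion (μ := fieldMeasure (F.P J) 0 (Matrix.specialUnitaryGroup (Fin 2) ℂ))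
      (f := heightDensity F γ' hJK (histGood F ℰp (θBal F.L γ b₀ p₀) K J))).mono hR
  exact (hc.log fun V hV => (hP V hV).ne').add (continuousOn_const.mul hm)

/-- ★★★ **THE SMALL-FIELD TESTED FUNCTION IS CONTINUOUS ON THE WINDOW — EVERY `L ≥ 5`, ZERO LETTERS**: for every block size `L ≥ 5` and profile `(b₀, p₀)`
there is `ε₁ > 0` such that for every `0 < ε₀ ≤ ε₁` there is a coupling threshold below which, for every member with `F.L = L`, every `J ≤ K`, every
weight coupling `γ′ > 0` and every coefficient `β`, `V ↦ log heightDensityCan F γ′ hJK (histGood(θBal γ) K J) V + β·minActionRegPr F J K hJK ε₀ V` is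
`ContinuousOn {PlaqSmall (θBal F.L γ b₀ p₀ J)}` — the registry's `fluctAtCan … λ` is the instance `γ′ := γ/λ`, `β := β_K(γ/λ)`.  (✓WREG ∧ §2.)
[cite: Balaban1985UV3, (7) p.257 and (41) p.266; Balaban1985Variational, Thm 1 (8) p.279] -/
theorem continuousOn_smallFieldIntegrand_five (L : ℕ) (h5 : 5 ≤ L) (b₀ p₀ : ℝ) (hb : 0 < b₀) (hp : 0 < p₀) :
    ∃ ε₁ : ℝ, 0 < ε₁ ∧ ∀ (ε₀ : ℝ), 0 < ε₀ → ε₀ ≤ ε₁ →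
      ∃ γ₁ : ℝ, 0 < γ₁ ∧ ∀ (F : T3Family) (γ : ℝ), F.L = L → 0 < γ → γ ≤ γ₁ →
        ∀ (J K : ℕ) (hJK : J ≤ K) (γ' : ℝ), 0 < γ' → ∀ β : ℝ,
          ContinuousOn (fun V => Real.log (heightDensityCan F γ' hJK (histGood F ℰp (θBal F.L γ b₀ p₀) K J) V)
              + β * minActionRegPr F J K hJK ε₀ V) {V | PlaqSmall (θBal F.L γ b₀ p₀ J) V} := by
  obtain ⟨ε₁, hε₁, hA⟩ := continuousOn_minActionRegPr_window_five_le L h5 b₀ p₀ hb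
  obtain ⟨γW, hγW, hW⟩ := windowRegularity L b₀ p₀ hb hp
  refine ⟨ε₁, hε₁, fun ε₀ hε₀ hε₀e => ?_⟩
  obtain ⟨γA, hγA, hA'⟩ := hA ε₀ hε₀ hε₀e
  refine ⟨min γA γW, lt_min hγA hγW, fun F γ hF hγ hγle J K hJK γ' hγ' β => ?_⟩
  obtain ⟨hR, hP⟩ := hW F γ hF hγ (hγle.trans (min_le_right _ _)) J K hJK γ' hγ'
  exact continuousOn_integrand_of_letters F hJK hR hP (hA' F γ hF hγ (hγle.trans (min_le_left _ _)) J K hJK)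

/-- ★★ **THE SAME AT EVERY ODD `L > 1` FROM THE THM-1 LETTER** (✓WREG is letter-free at every `L`). [cite: Balaban1985UV3, (7) p.257 and (41) p.266; Balaban1985Variational, Thm 1 (8) p.279] -/
theorem continuousOn_smallFieldIntegrand_of_thm1
    (hT : ∀ L : ℕ, Odd L → 1 < L → ∃ a₀ a₁ B₃ : ℝ, 0 < a₀ ∧ 0 < a₁ ∧ 0 < B₃ ∧ Thm1GlobalMinAt L a₀ a₁ B₃) :
    ∀ (L : ℕ) (b₀ p₀ : ℝ), 0 < b₀ → 0 < p₀ → ∃ ε₁ : ℝ, 0 < ε₁ ∧ ∀ (ε₀ : ℝ), 0 < ε₀ → ε₀ ≤ ε₁ →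
      ∃ γ₁ : ℝ, 0 < γ₁ ∧ ∀ (F : T3Family) (γ : ℝ), F.L = L → 0 < γ → γ ≤ γ₁ →
        ∀ (J K : ℕ) (hJK : J ≤ K) (γ' : ℝ), 0 < γ' → ∀ β : ℝ,
          ContinuousOn (fun V => Real.log (heightDensityCan F γ' hJK (histGood F ℰp (θBal F.L γ b₀ p₀) K J) V)
              + β * minActionRegPr F J K hJK ε₀ V) {V | PlaqSmall (θBal F.L γ b₀ p₀ J) V} := by
  intro L b₀ p₀ hb hp
  obtain ⟨ε₁, hε₁, hA⟩ := continuousOn_minActionRegPr_window_of_thm1_le hT L b₀ p₀ hb hp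
  obtain ⟨γW, hγW, hW⟩ := windowRegularity L b₀ p₀ hb hp
  refine ⟨ε₁, hε₁, fun ε₀ hε₀ hε₀e => ?_⟩
  obtain ⟨γA, hγA, hA'⟩ := hA ε₀ hε₀ hε₀e
  refine ⟨min γA γW, lt_min hγA hγW, fun F γ hF hγ hγle J K hJK γ' hγ' β => ?_⟩
  obtain ⟨hR, hP⟩ := hW F γ hF hγ (hγle.trans (min_le_right _ _)) J K hJK γ' hγ'
  exact continuousOn_integrand_of_letters F hJK hR hP (hA' F γ hF hγ (hγle.trans (min_le_left _ _)) J K hJK)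

end Integrand

end Summit.QuantumFields.YangMills.Theorems.FluctuationComparisonRegPrIntLS2BetaSmallFieldIntegrandContinuousOn

end
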